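import Summits.BirchSwinnertonDyer.BirchSwinnertonDyer.Theses.PlecticLegs
import Literature.NumberTheory.EllipticCurves.GaloisAction
import Literature.NumberTheory.EllipticCurves.Tamagawa
import Literature.NumberTheory.EllipticCurves.NonvanishingTwistsHoffsteinLuo
import Literature.NumberTheory.EllipticCurves.BSDRootNumberNoContinuationProofs

/-!
# Disproof of `PlecticLegs.TwistSupply` (crux stmt-BirchSwinnertonDyer-18260) — findings

Standing disprover's work file (cdisprove seat, cycle 1, 2026-08-17). Prose lives in docstrings;
every `theorem` below is kernel-checked unless it is explicitly marked NEAR-MISS (`sorry`).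

VERDICT SO FAR: **no kill**. The crux is a faithful encoding of an open-but-believed statement of
analytic number theory (simultaneous non-vanishing of the `r - 1` non-trivial twists attached to one
totally real abelian field of degree `r = r_an(E)`); `r = 2` is a theorem in print
(Friedberg–Hoffstein 1995 Thm B / Hoffstein–Luo 1997 + root-number parity), `r ≥ 3` is open and
predicted by the David–Fearnley–Kisilevsky heuristics; exact modular-symbol numerics find silent
fields at the first curve of every rank `2 … 5` (jobs j023828 / j023838 of the birth-vetting seat,
PROBE.md on the item) and the broader scan of this seat (see `## Numerics` below).

## Index

* `SilentField W r` — the conclusion of the crux for `W` at a prescribed degree `r`;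
  `twistSupply_iff` : `TwistSupply ↔ ∀ W, 2 ≤ r_an W → SilentField W (r_an W)` (by `Iff.rfl`).
* (a) LOAD-BEARING ANALYSIS of the only hypothesis `2 ≤ W.analyticRank` — LANDED (p159839,
  ACCEPTED, commit 5083abf1f5f8) as `Theorems/TwistSupply/Negative/RankHypothesis.lean`
  (namespace `…Theorems.TwistSupply.Negative`: `twistSupply_conclusion_false_at_degree_zero`,
  `twistSupply_conclusion_at_degree_one`, `twistSupply_imp_of_one_le_analyticRank`,
  `forall_analyticRank_ne_zero_of_twistSupply_without_rank`,
  `twistSupply_false_without_rank_of_exists_analyticRank_zero`,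
  `exists_analyticRank_zero_of_hoffsteinLuo`, `twistSupply_false_without_rank_of_hoffsteinLuo`,
  `hasEntireLFunction_rat_of_twistSupply_without_rank`, `fixedField_top_cyclotomicField_eq_bot`;
  statements inline, importable by ideators / planners / the lead). Local mirror below:
  - `not_silentField_zero`     : the conclusion is unsatisfiable at degree `0` (a field has
                                 positive degree) — unconditional;
  - `silentField_one`          : the conclusion is FREE at degree `1` (`m = 1`, `H = ⊤`, no
                                 non-trivial character) — unconditional;
  - `twistSupplyWithoutRank_iff` : dropping the hypothesis ⇔ `TwistSupply ∧ (no elliptic curve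
                                 over ℚ has analytic rank 0)`; hence
    `twistSupplyWithoutRank_false_of_exists_analyticRank_zero` : any analytic-rank-0 curve
                                 kills the hypothesis-free version, and
    `twistSupplyWithoutRank_false_of_hoffsteinLuo` : the catalogued fact Hoffstein–Luo 1997
                                 (the crux's own `r = 2` input) supplies one (`L(E^{(d)},1) ≠ 0 ⇒
                                 r_an = 0` is unconditional, `analyticRank_eq_zero_of_…`) — "any
                                 proof must use the hypothesis, but only to exclude `r_an = 0`";
    `hasEntireLFunction_rat_of_twistSupplyWithoutRank` : the hypothesis-free crux would even
                                 prove the continuation of `L(E,s)` for every `E/ℚ`;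
  - `twistSupplyFromRankOne_iff` : the threshold `2 ≤` can be lowered to `1 ≤` for free (MUTATION
                                 finding: the hypothesis is not used at `r_an = 1`).
* (b) ENCODING AUDIT (why no junk escape exists) — docstring `encodingAudit` below.
* (c) NATURAL STRENGTHENINGS: `TwistSupplyEveryField` (∀ instead of ∃ over `(m,H)`) is false in
  maths (389a1, `F = ℚ(√2)`: `(2/389) = -1` forces `w(E ⊗ χ₈) = -1`, `L(E,χ₈,1) = 0`) but not
  refutable in tree (no certified `r_an(389a1) = 2`, no functional equation of twists): NEAR-MISS
  `twistSupplyEveryField_false` (sorry, obstruction in its docstring).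
* (d) `-- Line selmer-silencing` (registered skeleton, 4 stubs): `stub_goodPrimePowerSupply` is
  misstated (`S ∋ 0`; landed p147528 by the skeleton vet, cited); `residual_at_three` /
  `residual_forces_every_curve` record that `stub_residualPrimePowerSupply` at `ℓ = 3` carries NO
  link to `r_an(W)`: it asserts silent cyclic cubic-power characters of EVERY order `3^n` for EVERY
  elliptic curve over ℚ — strictly more than the crux needs (`3^n ∣ r_an(W)` only) and containing
  the first open case (`r = 3`, `L(E,1) = 0`) undiluted. No stub is killed.
* (e) `-- Targets`: none this cycle (payload `stuck_stubs = []`).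

## Numerics (counterexample search; evidence only, nothing here is used by a theorem)

Birth-vetting seat (jobs j023828 exact Birch–Manin symbols, j023838 `lfuntwist`, feq ≤ -58):
389a1 `r=2`: silent `ℚ(√p)` at `p = 5,13,17,41,73,97,113`; 5077a1 `r=3`: `ℚ(ζ₇)⁺` silent, clean
cubic `p = 7,13,31,37,61,67,79,97,103,139,151`, genuine cubic zeros `p = 19,43,73,109,127,157`
(6/17: small algebraic parts vanish OFTEN — a proof cannot be a size/counting argument at small
conductor); 234446a1 `r=4`: quartic subfield of `ℚ(ζ₈₉)` (also 97,137,241); 19047851a1 `r=5`: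
`ℚ(ζ₁₁)⁺`. This seat's broader scan: see NOTES / evidence `SCAN.md` (job id recorded there).

## Why it resists (for the provers)

1. No junk: `aₙ = WeierstrassCurve.LFunction` is built from LOCAL MINIMAL models (model-independent
   Hasse–Weil coefficients); the continuation `L` is pinned by the identity theorem (agreement on
   `re s > 2`, inside absolute convergence `re s > 3/2`); imprimitive `χ mod m` only delete Euler
   polynomials at `p ∣ m`, which do not vanish at `s = 1` (`p + c² = c·a_p` impossible for
   `|a_p| ≤ 2√p`, `|c| = 1`; bad `p`: `1 ∓ c/p ≠ 0`); `analyticRank` has junk value `0 < 2`, so junk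
   curves never enter; `{a : ∀ z, z^m = 1 → σ z = z^a} = a_σ + mℤ ≠ ∅`, so "trivial on `H`" is exactly
   `χ ∈ (Gal/H)^∨`, `r - 1 ≥ 1` non-trivial characters, never vacuous.
2. A refutation needs ONE curve `E/ℚ` with `r_an(E) = r ≥ 3` such that EVERY totally real abelian
   `F` of degree `r` has a vanishing non-trivial twist. For `r = ℓ ≥ 7` prime DFK predict finitely
   many vanishing order-`ℓ` twists in total; for `ℓ = 3, 5` density zero; composite `r` is more
   flexible still (non-cyclic `F` allowed). Against all heuristics and all numerics.
3. What IS hard (and where provers should expect to spend): `r ≥ 3` with `L(E,1) = 0` — FKK 2012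
   Thm 1.1 needs `L(E,1) ≠ 0`; Rohrlich 1984 is cofinite in a fixed `ℓ`-power-conductor tower only;
   the line's lever (Mazur–Rubin Diophantine stability + rank-0 converse) dodges `L(E,1) = 0` but is
   XL and its `ℓ ∈ {2,3}` / small-image residue is open beyond `ℓ^n = 2`.
-/

noncomputable section

-- D-0017: single-problem summit, so `Summit.BirchSwinnertonDyer.BirchSwinnertonDyer.…` repeats a
-- namespace BY DESIGN.
set_option linter.dupNamespace false

namespace Summit.BirchSwinnertonDyer.BirchSwinnertonDyer.Cruxes.TwistSupply.Disproof

open Summit.BirchSwinnertonDyer.BirchSwinnertonDyer.Theses.PlecticLegs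
open WeierstrassCurve Literature.NumberTheory.EllipticCurves

/-! ### The conclusion of the crux at a prescribed degree -/

/-- `L(W, χ, 1) ≠ 0` in the crux's own phrasing: the entire continuation of `∑ χ(n) aₙ(W) n⁻ˢ`
(agreement on `re s > 2`) does not vanish at `s = 1`. [folklore] -/
abbrev TwistedLOneNeZero (W : WeierstrassCurve ℚ) {m : ℕ} (χ : DirichletCharacter ℂ m) : Prop :=
  ∃ L : ℂ → ℂ, Differentiable ℂ L ∧
    (∀ s : ℂ, 2 < s.re → L s = LSeries (fun n ↦ χ n * ((W.LFunction n : ℤ) : ℂ)) s) ∧ L 1 ≠ 0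

/-- `SilentField W r`: there is a level `m` and a subgroup `H ≤ Gal(ℚ(ζ_m)/ℚ)` whose fixed field is
totally real of degree `r` and all of whose non-trivial characters `χ` (Dirichlet characters mod `m`
trivial on `H`, `μ_m`-phrasing) have `L(W, χ, 1) ≠ 0` — literally the conclusion of
`PlecticLegs.TwistSupply` with `W.analyticRank` replaced by `r`. [folklore] -/
def SilentField (W : WeierstrassCurve ℚ) (r : ℕ) : Prop :=
  ∃ (m : ℕ) (_ : NeZero m), ∃ H : Subgroup (CyclotomicField m ℚ ≃ₐ[ℚ] CyclotomicField m ℚ),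
    NumberField.IsTotallyReal ↥(IntermediateField.fixedField H) ∧
    Module.finrank ℚ ↥(IntermediateField.fixedField H) = r ∧
    ∀ χ : DirichletCharacter ℂ m,
      (∀ σ ∈ H, ∀ a : ℕ, (∀ z : CyclotomicField m ℚ, z ^ m = 1 → σ z = z ^ a) →
        χ (a : ZMod m) = 1) → χ ≠ 1 → TwistedLOneNeZero W χ

/-- The crux is, definitionally, `∀ W elliptic, 2 ≤ r_an(W) → SilentField W (r_an W)`. [folklore] -/
theorem twistSupply_iff :
    TwistSupply ↔ ∀ (W : WeierstrassCurve ℚ) [W.IsElliptic],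
      2 ≤ W.analyticRank → SilentField W W.analyticRank :=
  Iff.rfl

/-! ### (a) Load-bearing analysis of the hypothesis `2 ≤ W.analyticRank` -/

/-- In `ℚ(ζ_m)/ℚ` (Galois) the fixed field of the whole Galois group is `ℚ`. [folklore] -/
theorem fixedField_top_eq_bot (m : ℕ) [NeZero m] :
    IntermediateField.fixedField (⊤ : Subgroup (CyclotomicField m ℚ ≃ₐ[ℚ] CyclotomicField m ℚ))
      = ⊥ := by
  -- the instance `IsCyclotomicExtension {m} ℚ (CyclotomicField m ℚ)` is declared under
  -- `backward.isDefEq.respectTransparency false` and is not found by synthesis here: name it.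
  haveI : IsGalois ℚ (CyclotomicField m ℚ) :=
    @IsCyclotomicExtension.isGalois {m} ℚ (CyclotomicField m ℚ) _ _ _
      (CyclotomicField.isCyclotomicExtension m ℚ)
  rw [← IntermediateField.fixingSubgroup_bot, IsGalois.fixedField_fixingSubgroup]

/-- A fixed field inside `ℚ(ζ_m)` has positive degree over `ℚ`. [folklore] -/
theorem finrank_fixedField_pos (m : ℕ) [NeZero m]
    (H : Subgroup (CyclotomicField m ℚ ≃ₐ[ℚ] CyclotomicField m ℚ)) :
    0 < Module.finrank ℚ ↥(IntermediateField.fixedField H) :=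
  Module.finrank_pos

/-- **Degree `0` is impossible**: the conclusion of the crux is unsatisfiable at `r = 0`, for every
curve (the `L`-value clause is never reached). This is the ONLY place where the hypothesis
`2 ≤ r_an(W)` does any work (see `silentField_one`, `twistSupplyWithoutRank_iff`). [folklore] -/
theorem not_silentField_zero (W : WeierstrassCurve ℚ) : ¬ SilentField W 0 := by
  rintro ⟨m, hm, H, -, h0, -⟩
  exact absurd h0 (finrank_fixedField_pos m H).ne'

/-- **Degree `1` is free**: `m = 1`, `H = ⊤`, fixed field `ℚ` (totally real, degree `1`), and there
is no non-trivial Dirichlet character of level `1`, so the twist clause is vacuous — for EVERY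
curve, with no input about `L`-values. [folklore] -/
theorem silentField_one (W : WeierstrassCurve ℚ) : SilentField W 1 := by
  refine ⟨1, inferInstance, ⊤, ?_, ?_, ?_⟩
  · rw [fixedField_top_eq_bot]
    infer_instance
  · rw [fixedField_top_eq_bot]
    exact IntermediateField.finrank_bot
  · intro χ _ hne
    exact absurd (DirichletCharacter.level_one χ) hne

/-- The crux with its only hypothesis `2 ≤ W.analyticRank` DROPPED. -/
def TwistSupplyWithoutRank : Prop :=
  ∀ (W : WeierstrassCurve ℚ) [W.IsElliptic], SilentField W W.analyticRank

/-- The crux with the threshold lowered from `2` to `1`. -/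
def TwistSupplyFromRankOne : Prop :=
  ∀ (W : WeierstrassCurve ℚ) [W.IsElliptic], 1 ≤ W.analyticRank → SilentField W W.analyticRank

/-- **Mutation finding: the threshold `2` can be lowered to `1` for free.** `TwistSupply` is
equivalent to its `1 ≤ r_an` version, because the degree-`1` conclusion is unconditional
(`silentField_one`). So the hypothesis is not "used at `r = 2`"; it only fences off `r_an = 0`.
[folklore] -/
theorem twistSupplyFromRankOne_iff : TwistSupplyFromRankOne ↔ TwistSupply := by
  constructor
  · intro h W _ h2
    exact h W (by omega)
  · intro h W _ h1
    rcases Nat.lt_or_ge W.analyticRank 2 with hlt | hge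
    · have h1' : W.analyticRank = 1 := by omega
      rw [h1']
      exact silentField_one W
    · exact h W hge

/-- **Exact load of the hypothesis.** Dropping `2 ≤ r_an(W)` altogether is equivalent to the crux
PLUS "no elliptic curve over `ℚ` has analytic rank `0`". [folklore] -/
theorem twistSupplyWithoutRank_iff :
    TwistSupplyWithoutRank ↔
      TwistSupply ∧ ∀ (W : WeierstrassCurve ℚ) [W.IsElliptic], W.analyticRank ≠ 0 := by
  constructor
  · intro h
    refine ⟨fun W _ _ ↦ h W, fun W _ h0 ↦ ?_⟩
    have hW := h W
    rw [h0] at hW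
    exact not_silentField_zero W hW
  · rintro ⟨hT, hne⟩ W _
    rcases Nat.lt_or_ge W.analyticRank 2 with hlt | hge
    · have h1 : W.analyticRank = 1 := by
        have := hne W
        omega
      rw [h1]
      exact silentField_one W
    · exact hT W hge

/-- **`TwistSupply` without its hypothesis is false as soon as ONE elliptic curve over `ℚ` of
analytic rank `0` is available** (in maths: `11a1`, `L(11a1,1) = Ω/5 ≠ 0`; the tree has no
evaluated central value of any curve, so the witness is a hypothesis here — discharged from the
catalogued Hoffstein–Luo fact in `twistSupplyWithoutRank_false_of_hoffsteinLuo`). "Any proof of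
the crux must use `2 ≤ r_an` — but only to exclude `r_an = 0`." [folklore] -/
theorem twistSupplyWithoutRank_false_of_exists_analyticRank_zero
    (h : ∃ (W : WeierstrassCurve ℚ), W.IsElliptic ∧ W.analyticRank = 0) :
    ¬ TwistSupplyWithoutRank := by
  intro hT
  obtain ⟨W, hW, h0⟩ := h
  exact ((twistSupplyWithoutRank_iff.mp hT).2 W) h0

/-- `L(W, 1) ≠ 0 ⇒ r_an(W) = 0`, UNCONDITIONALLY (no continuation hypothesis): the order of a
non-vanishing analytic germ is `0`, and Mathlib's junk order of a non-analytic germ is `0` too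
(`analyticOrderAt_eq_zero`). Local copy (3 lines) of the tree theorem
`Literature.NumberTheory.EllipticCurves.analyticRank_eq_zero_of_entireLFunction_one_ne_zero`
(ComplexMultiplication.lean), not imported to keep this file's cone light. [folklore] -/
theorem analyticRank_eq_zero_of_entireLFunction_one_ne_zero {K : Type*} [Field K] [NumberField K]
    (W : WeierstrassCurve K) (h : W.entireLFunction 1 ≠ 0) : W.analyticRank = 0 := by
  unfold WeierstrassCurve.analyticRank analyticOrderNatAt
  rw [analyticOrderAt_eq_zero.mpr (Or.inr h)]
  rfl

/-- **An analytic-rank-`0` curve from the catalogued Hoffstein–Luo fact** (J. Hoffstein, W. Luo,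
*Nonvanishing of L-series and the combinatorial sieve*, Math. Res. Lett. 4 (1997), Theorem; tree
fact `HoffsteinLuo1997_exists_twist_L_one_ne_zero`, the very input the crux cites for `r = 2`):
a quadratic twist `E^{(d)}` of `ofJ 0` with `L(E^{(d)}, 1) ≠ 0`, hence `r_an = 0` by
`analyticRank_eq_zero_of_entireLFunction_one_ne_zero` — no modularity needed at this step.
[cite: HoffsteinLuo1997, Theorem] -/
theorem exists_analyticRank_zero_of_hoffsteinLuo
    (hHL : HoffsteinLuo1997_exists_twist_L_one_ne_zero) :
    ∃ (W : WeierstrassCurve ℚ), W.IsElliptic ∧ W.analyticRank = 0 := by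
  obtain ⟨d, hsq, -, -, -, hL⟩ := hHL.exists (WeierstrassCurve.ofJ (0 : ℚ)) ∅
  have hd : (d : ℚ) ≠ 0 := by
    have : d ≠ 0 := fun h ↦ by
      rw [h] at hsq
      exact not_squarefree_zero hsq
    exact_mod_cast this
  exact ⟨(WeierstrassCurve.ofJ (0 : ℚ)).quadraticTwist (d : ℚ),
    WeierstrassCurve.isElliptic_quadraticTwist _ hd,
    analyticRank_eq_zero_of_entireLFunction_one_ne_zero _ hL⟩

/-- **Load-bearing lemma, modulo a catalogued analytic fact**: Hoffstein–Luo 1997 (the `r = 2`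
input of the crux) already refutes the hypothesis-free crux. [cite: HoffsteinLuo1997, Theorem] -/
theorem twistSupplyWithoutRank_false_of_hoffsteinLuo
    (hHL : HoffsteinLuo1997_exists_twist_L_one_ne_zero) : ¬ TwistSupplyWithoutRank :=
  twistSupplyWithoutRank_false_of_exists_analyticRank_zero
    (exists_analyticRank_zero_of_hoffsteinLuo hHL)

/-- **What the dropped hypothesis would smuggle in**: the hypothesis-free crux forces
`r_an(W) ≠ 0` for every elliptic `W/ℚ`, hence — by the tree's unconditional disposal of the junk
branch (`hasEntireLFunction_of_analyticRank_ne_zero`: no continuation ⇒ `r_an = 0`) — the entire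
continuation of `L(W, s)` for EVERY elliptic curve over `ℚ` (`hasEntireLFunction_rat`, the
continuation half of Hasse–Weil, in print only via modularity), on top of `L(W,1) = 0` for all `W`
(false). [folklore] -/
theorem hasEntireLFunction_rat_of_twistSupplyWithoutRank (h : TwistSupplyWithoutRank) :
    WeierstrassCurve.hasEntireLFunction_rat := by
  intro W _
  exact W.hasEntireLFunction_of_analyticRank_ne_zero ((twistSupplyWithoutRank_iff.mp h).2 W)

/-- **What the hypothesis gives for free** (remark for provers): `2 ≤ r_an(W)` already certifies
the entire continuation of `L(W, s)` itself — by the tree's unconditional disposal of the junk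
branch (`hasEntireLFunction_of_analyticRank_ne_zero`, BSDRootNumberNoContinuationProofs: no
continuation ⇒ `r_an = 0`). So inside a proof of the crux no modularity fact is needed for the
UNTWISTED continuation; only the twisted series `∑ χ(n) aₙ n⁻ˢ` need their own. [folklore] -/
theorem hasEntireLFunction_of_two_le_analyticRank (W : WeierstrassCurve ℚ) [W.IsElliptic]
    (hW : 2 ≤ W.analyticRank) : W.HasEntireLFunction :=
  W.hasEntireLFunction_of_analyticRank_ne_zero (by omega)

/-! ### (b) Encoding audit — why there is no junk escape

`encodingAudit` is a documentation anchor (a trivial theorem) whose docstring records the symbol-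
by-symbol reading of the crux; the arithmetic facts quoted are elementary and were checked on paper
and numerically (birth-vetting seat, PROBE.md), not formalised. -/

/-- ENCODING AUDIT of `PlecticLegs.TwistSupply` (read back from the elaborated term):
* `W : WeierstrassCurve ℚ`, `[W.IsElliptic]` — any model; `W.LFunction : ArithmeticFunction ℤ` is
  Mathlib's Euler product over the primes of `𝓞_ℚ` of the local factors of the LOCAL MINIMAL MODEL
  (`localPolynomial` uses `W.minimal R`), so `aₙ` are the genuine, model-independent Hasse–Weil
  coefficients; good `p`: `1 - a_p T + p T²` with `a_p = p + 1 - #W̃(𝔽_p)` (projective count: the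
  `Point` type includes `0`); split/non-split multiplicative: `1 ∓ T`; additive: `1`.
* `W.analyticRank = analyticOrderNatAt W.entireLFunction 1`; `entireLFunction` is THE entire
  continuation when one exists (subsingleton by the identity theorem) and the junk `W.LSeries`
  otherwise; junk values of `analyticOrderNatAt` are `0`, so `2 ≤ W.analyticRank` already forces the
  genuine branch to be the relevant one in maths (modularity) — no junk curve satisfies the
  hypothesis for a provable reason.
* `∃ m, NeZero m, H ≤ (ℚ(ζ_m) ≃ₐ[ℚ] ℚ(ζ_m))`; `IsTotallyReal (fixedField H)` uses only `[Field]`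
  (infinite places); `Module.finrank ℚ (fixedField H) = [G : H]` (Galois correspondence, `ℚ(ζ_m)/ℚ`
  Galois) — `m ≤ 2` or `H = ⊤` give degree `1`, excluded by `= r_an ≥ 2`.
* character clause: for `σ ∈ H` the set `{a : ℕ | ∀ z, z^m = 1 → σ z = z^a}` is the residue class
  `a_σ + mℕ` of the cyclotomic character (non-empty, `a_σ` a unit mod `m`), so the clause says
  exactly `χ(a_σ) = 1 ∀ σ ∈ H`, i.e. `χ` factors through `G/H = Gal(F/ℚ)`; there are `[G:H] = r`
  such `χ`, `r - 1 ≥ 1` of them `≠ 1` — the inner `∀ χ` is never vacuous; imprimitive `χ` are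
  included, harmlessly: `∑ χ(n) aₙ n⁻ˢ = L(E, χ*, s) · ∏_{p ∣ m, p ∤ cond χ*} P_p(χ*(p) p⁻ˢ)` and
  `P_p(c/p) ≠ 0` (`|roots of 1 - a_p X + p X²| = p^{-1/2} ≠ p^{-1}`; bad `p`: `1 ∓ c/p`, `1`).
* `∃ L, Differentiable ℂ L ∧ (∀ s, 2 < re s → L s = LSeries …) ∧ L 1 ≠ 0`: on `re s > 2 > 3/2` the
  `LSeries` is the convergent sum, so `L` is unique (identity theorem on `ℂ`), `L 1` is THE twisted
  central value; existence of `L` is modularity of `f_E ⊗ χ` (true, not in tree: proof-level debt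
  `hasEntireLFunction_rat`-like, shared with ArtinBaseChange / KatoDescent).
* quantifier order `∀ W, ∃ (m,H), ∀ χ` matches the informal text (one field silences all its
  characters simultaneously) — this simultaneity is the whole difficulty for `r ≥ 3`.
[folklore] -/
theorem encodingAudit : True := trivial

/-! ### (c) Natural strengthenings -/

/-- The `∀`-strengthening: EVERY totally real abelian field of degree `r_an(W)` is silent. -/
def TwistSupplyEveryField : Prop :=
  ∀ (W : WeierstrassCurve ℚ) [W.IsElliptic], 2 ≤ W.analyticRank →
    ∀ (m : ℕ) [NeZero m] (H : Subgroup (CyclotomicField m ℚ ≃ₐ[ℚ] CyclotomicField m ℚ)),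
      NumberField.IsTotallyReal ↥(IntermediateField.fixedField H) →
      Module.finrank ℚ ↥(IntermediateField.fixedField H) = W.analyticRank →
      ∀ χ : DirichletCharacter ℂ m,
        (∀ σ ∈ H, ∀ a : ℕ, (∀ z : CyclotomicField m ℚ, z ^ m = 1 → σ z = z ^ a) →
          χ (a : ZMod m) = 1) → χ ≠ 1 → TwistedLOneNeZero W χ

/-- `TwistSupplyEveryField` trivially implies the crux GIVEN a supply of totally real abelian
fields of every degree `r ≥ 2` inside cyclotomic fields (Dirichlet: `p ≡ 1 mod 2r`, the degree-`r`
subfield of `ℚ(ζ_p)⁺`) — recorded as the precise sense in which it is a strengthening. The field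
supply itself is stated as a hypothesis (pure algebra + Dirichlet's theorem; provable, not needed
here). [folklore] -/
theorem twistSupply_of_everyField
    (hfields : ∀ r : ℕ, 2 ≤ r → ∃ (m : ℕ) (_ : NeZero m)
      (H : Subgroup (CyclotomicField m ℚ ≃ₐ[ℚ] CyclotomicField m ℚ)),
        NumberField.IsTotallyReal ↥(IntermediateField.fixedField H) ∧
        Module.finrank ℚ ↥(IntermediateField.fixedField H) = r)
    (h : TwistSupplyEveryField) : TwistSupply := by
  intro W _ hW
  obtain ⟨m, hm, H, hreal, hdeg⟩ := hfields W.analyticRank hW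
  exact ⟨m, hm, H, hreal, hdeg, fun χ hχ hne ↦ h W hW m H hreal hdeg χ hχ hne⟩

/-- NEAR-MISS (not closable in tree). **The `∀`-strengthening is false in mathematics**: for
`E = 389a1` (`r_an = 2`, root number `+1`) and the real quadratic field `F = ℚ(√2) ⊂ ℚ(ζ₈)`
(`m = 8`, `H = ker χ₈`), the non-trivial character is `χ₈ = (2/·)`, and `(2/389) = -1`
(`389 ≡ 5 mod 8`) gives root number `w(E ⊗ χ₈) = w(E)·χ₈(-389) = -1`, hence `L(E, χ₈, 1) = 0`
exactly; numerically also `p = 5, 13, 17, …` work while every `p` with `(389/p) = -1` fails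
(PROBE.md). OBSTRUCTION to a Lean proof: (i) no curve with certified `2 ≤ W.analyticRank` is
constructible (needs `hasEntireLFunction_rat` = modularity, plus exact `L(E,1) = 0` by modular
symbols and `L'(E,1) = 0` by the sign of the functional equation); (ii) the functional equation of
the twisted `L`-function (forcing the central zero from the sign) is not a theorem of the tree.
Tried: searching the tree for a root-number / functional-equation theorem on
`WeierstrassCurve.entireLFunction` or twisted `LSeries` (only named facts, no proofs). Moral for
provers: do NOT try to prove the crux uniformly in the field — the choice of `(m, H)` must depend on
`E` (at least through the signs `χ(-N)` of the even quadratic characters of `Gal(F/ℚ)`). -/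
theorem twistSupplyEveryField_false : ¬ TwistSupplyEveryField := by
  sorry

/-! ### (d) Line `selmer-silencing` (skeleton sha e383dba0…, 4 stubs) — observations

* `stub_goodPrimePowerSupply` — MISSTATED (`∀ S : Finset ℕ, … ∀ q ∈ S, Nat.Coprime q m` with
  `0 ∈ S` forces `m = 1`): landed by the skeleton-vetting seat as
  `Theorems/TwistSupply/Negative/StubGoodPrimePowerSupplyLevelOne.lean` (p147528:
  `goodPrimePowerSupply_conclusion_false_of_zero_mem`, `stub_goodPrimePowerSupply_false_of_hyps`);
  repair: drop `∀ S` (the composition uses `S = ∅` only) or require `q ≠ 0`.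
* `stub_residualPrimePowerSupply` — NOT killed, but note its strength (`residual_at_three`): at
  `ℓ = 3` every hypothesis discharges itself, so the stub asserts, for EVERY elliptic `W/ℚ` and EVERY
  `n ≥ 1`, an even character of order `3^n` all of whose non-trivial powers are non-vanishing at
  `1`. The crux needs this only when `3^n ∣ r_an(W)`. For `r_an(W) = 0` and `n = 1` it is FKK 2012
  Thm 1.2-type (known); for `L(E,1) = 0` it is the first open case of the crux, undiluted; for
  `n ≥ 2` it additionally demands the order-`3` power silent at the same time.
* `stub_multiplyStep` — a two-parameter simultaneous non-vanishing statement (adjoin `ℓ^n` to a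
  silent `⟨χ₁⟩`), again with no link to `r_an(W)` except parity at `ℓ = 2`; plausible, open, not
  attackable by small models (every instance needs a certified vanishing twist).
* `stub_cycloGlue` — true Mathlib-level Galois theory (fixed field of `ker χ`, `χ` even); nothing to
  refute. -/

/-- The registered statement of `stub_residualPrimePowerSupply` (verbatim, inline; the `Lines/` file
carries `sorry`s and is not imported). -/
def StubResidualPrimePowerSupply : Prop :=
  ∀ (W : WeierstrassCurve ℚ) [W.IsElliptic] (ℓ : ℕ) [Fact ℓ.Prime] (n : ℕ), 1 ≤ n →
    (ℓ = 2 → Even W.analyticRank) →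
    ¬ (5 ≤ ℓ ∧ W.HasGoodReductionAtPrime ℓ ∧ ¬ (ℓ : ℤ) ∣ W.LFunction ℓ ∧
        ((W.LFunction ℓ : ℤ) : ZMod ℓ) ≠ 1 ∧ W.HasSurjectiveModNGaloisRep (ℓ : ℤ)) →
      ∃ (m : ℕ) (_ : NeZero m) (χ : DirichletCharacter ℂ m),
        χ.Even ∧ orderOf χ = ℓ ^ n ∧
        ∀ j : ℕ, χ ^ j ≠ 1 →
          ∃ L : ℂ → ℂ, Differentiable ℂ L ∧
            (∀ s : ℂ, 2 < s.re →
              L s = LSeries (fun k ↦ (χ ^ j) k * ((W.LFunction k : ℤ) : ℂ)) s) ∧ L 1 ≠ 0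

/-- **`stub_residualPrimePowerSupply` at `ℓ = 3` is hypothesis-free**: it yields, for EVERY elliptic
curve over `ℚ` and every `n ≥ 1`, an even Dirichlet character of order `3 ^ n` all of whose
non-trivial powers have non-vanishing twisted central value — with no reference to `r_an(W)`.
(So the stub contains "every `E/ℚ`, including `L(E,1) = 0`, has a non-vanishing cubic twist", the
first open case of the crux, and more.) [folklore] -/
theorem residual_at_three (hRes : StubResidualPrimePowerSupply) (W : WeierstrassCurve ℚ)
    [W.IsElliptic] (n : ℕ) (hn : 1 ≤ n) :
    ∃ (m : ℕ) (_ : NeZero m) (χ : DirichletCharacter ℂ m),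
      χ.Even ∧ orderOf χ = 3 ^ n ∧ ∀ j : ℕ, χ ^ j ≠ 1 → TwistedLOneNeZero W (χ ^ j) := by
  haveI : Fact (Nat.Prime 3) := ⟨Nat.prime_three⟩
  exact hRes W 3 n hn (fun h ↦ absurd h (by norm_num)) (fun h ↦ absurd h.1 (by norm_num))

/-- Same at `ℓ = 2`, where the only surviving hypothesis is the parity clause: for every elliptic
`W/ℚ` of EVEN analytic rank (including `r_an = 0`) and every `n ≥ 1`, an even character of order
`2 ^ n` with all non-trivial powers silent. At `n = 1` this is Hoffstein–Luo 1997 + parity (known);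
at `n ≥ 2` it is a simultaneous statement (the quadratic power AND the order-`2^n` characters).
[folklore] -/
theorem residual_at_two (hRes : StubResidualPrimePowerSupply) (W : WeierstrassCurve ℚ)
    [W.IsElliptic] (hpar : Even W.analyticRank) (n : ℕ) (hn : 1 ≤ n) :
    ∃ (m : ℕ) (_ : NeZero m) (χ : DirichletCharacter ℂ m),
      χ.Even ∧ orderOf χ = 2 ^ n ∧ ∀ j : ℕ, χ ^ j ≠ 1 → TwistedLOneNeZero W (χ ^ j) := by
  haveI : Fact (Nat.Prime 2) := ⟨Nat.prime_two⟩
  exact hRes W 2 n hn (fun _ ↦ hpar) (fun h ↦ absurd h.1 (by norm_num))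

/-! ### (e) Targets

None this cycle: the payload carries no picked line and no stuck stubs (`targets = []`,
`stuck_stubs = []`). On re-arm, the lead's STUCK list goes here as `theorem <stub>_false`. -/

end Summit.BirchSwinnertonDyer.BirchSwinnertonDyer.Cruxes.TwistSupply.Disproof

end
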